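import Summits.BirchSwinnertonDyer.Rank1Residual.GaloisImage.NineDivisionFrobeniusCertificate
import Literature.NumberTheory.EllipticCurves.DivisionPolynomialMultiplication
import Mathlib.Algebra.CharP.Lemmas
import Mathlib.Algebra.CharP.Algebra
import HarnessLib

/-!
# From the `9`-division Frobenius certificate to POINTS of the reduced curve over an algebraically
# closed field of characteristic `ℓ`: a `9`-torsion point MOVED by the `ℓ^m`-power map, and every
# `3`-torsion point FIXED by it (cell `b2b-bsdres`, team n1011, seat p03 gen 6 — row T-b11-FROB9 PART 1b)

HONEST FRAMING (cell `b2b-bsdres`, run/shared/lean/b2b/bsd-rank1-residual/, verbatim in every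
file): the goal of the cell is to DELETE the COMBINATION-SHAPED residual classes of the
Birch–Swinnerton-Dyer formula for ALL analytic-rank `≤ 1` elliptic curves over `ℚ` — "full BSD
formula for every rank `≤ 1` curve in class `C`" assembled STRICTLY from published theorems — so
that the rank-`≤ 1` remainder becomes exactly the CONSTRUCTION-SHAPED classes, which are TYPED
(missing-input `Prop`s), NOT attempted. This is not "finishing BSD". Team n1011 (N10 / N11):
research route; theorems only (no definition, no named fact); nothing is booked; no label moved.

## What this file proves

Let `E₀` be an integer equation, `ℓ` a prime with `ℓ ∤ Δ(E₀)`, `Ẽ = E₀ mod ℓ`, `K` an algebraically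
closed field with a ring homomorphism `ι : ℤ/ℓ → K`, `Ẽ_K = Ẽ.map ι` (nonsingular), `q = ℓ^m`.  From a
kernel-checked certificate `Frob9.check ℓ E₀ m …` (file B):

* `evalEval_ψ_eq_eval_preΨ'_of_equation` — on a point of the curve, for ODD `n`, `ψₙ(x, y) = preΨ'ₙ(x)`
  (Mathlib `Affine.CoordinateRing.mk_ψ` + `Ψ_ofNat`);
* `exists_point_nine_torsion_pow_ne_of_check` — **some nonsingular point `(x₀, y₀)` of `Ẽ_K` has
  `(9 : ℤ) • (x₀, y₀) = O` and `x₀ ^ q ≠ x₀`** (tree `Affine.Point.zsmul_some_eq_zero_iff`, Silverman Ex. 3.7 (f));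
* `pow_eq_of_three_torsion_of_check` — **every nonsingular point `(x, y)` of `Ẽ_K` with `(3 : ℤ) • (x, y) = O`
  has `x ^ q = x` and `y ^ q = y`** (`ψ₃ = Ψ₃` vanishes at `x`; the `ψ₃` part of the certificate gives
  `x^q = x` and `Ψ₂Sq(x)^e = 1` with `2e + 1 = q`; on the curve `Ψ₂Sq(x) = (2y + a₁x + a₃)²`, so
  `z := 2y + a₁x + a₃` has `z^q = z·(z²)^e = z`, and `y^q = y` because `x ↦ x^q` is a ring map fixing
  `ι(ℤ/ℓ)` and `2`; `pow_eq_of_equation_of_Ψ₂Sq_pow_eq_one`).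

The `q`-power map is how the `#k`-power Frobenius acts on `Ẽ(k̄)` (`(x, y) ↦ (x^ℓ, y^ℓ)`); PART 2 transports
these two statements to `E[9]` / `E[3]` along `exists_reduceTorsionHom`, giving F0's hypotheses for
`τ = σ^{m/3}`.  Nothing booked.

References: [SilvermanAEC2009] Exercise 3.7 (d)(f), III.1, III.2.3; Mathlib `WeierstrassCurve.Ψ_ofNat`,
`Affine.CoordinateRing.mk_ψ`, `ψ₂_sq`; tree `DivisionPolynomialMultiplication` (`zsmul_some_eq_zero_iff`).
-/

noncomputable section

open scoped Classical Polynomial.Bivariate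

open Polynomial WeierstrassCurve

namespace Summit.BirchSwinnertonDyer.Rank1Residual.GaloisImage.Frob9

/-- **On a point of the curve, `ψₙ(x, y) = preΨ'ₙ(x)` for odd `n`**: `ψₙ ≡ Ψₙ (mod W(X,Y))`
(Mathlib `Affine.CoordinateRing.mk_ψ`) and `Ψₙ = C (preΨ'ₙ)` for odd `n` (`Ψ_ofNat`).
[cite: SilvermanAEC2009, Exercise 3.7 (d)] -/
theorem evalEval_ψ_eq_eval_preΨ'_of_equation {R : Type*} [CommRing R] (W : WeierstrassCurve R)
    {x y : R} (h : W.toAffine.Equation x y) (n : ℕ) (hn : ¬ Even n) :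
    (W.ψ n).evalEval x y = (W.preΨ' n).eval x := by
  have hmk := Affine.CoordinateRing.mk_ψ (W := W) n
  rw [AdjoinRoot.mk_eq_mk] at hmk
  obtain ⟨c, hc⟩ := hmk
  have hc' : W.ψ n = W.Ψ n + W.toAffine.polynomial * c := by rw [← hc]; ring
  have hΨ : W.Ψ n = Polynomial.C (W.preΨ' n) := by
    rw [Ψ_ofNat, if_neg (by exact_mod_cast hn), mul_one]
  have h0 : W.toAffine.polynomial.evalEval x y = 0 := h
  rw [hc', hΨ, ← coe_evalEvalRingHom, map_add, map_mul, coe_evalEvalRingHom, h0, zero_mul, add_zero,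
    evalEval_C]

/-- **On a point of the curve, `Ψ₂Sq(x) = (2y + a₁x + a₃)²`** (Mathlib `ψ₂_sq`: `ψ₂² = C Ψ₂Sq + 4·W(X,Y)`,
`ψ₂ = ∂W/∂Y`). [cite: SilvermanAEC2009, III.1 (b-invariants) and Exercise 3.7] -/
theorem eval_Ψ₂Sq_eq_sq_of_equation {R : Type*} [CommRing R] (W : WeierstrassCurve R) {x y : R}
    (h : W.toAffine.Equation x y) : (W.Ψ₂Sq).eval x = (2 * y + W.a₁ * x + W.a₃) ^ 2 := by
  have hsq := congrArg (Polynomial.evalEval x y) (W.ψ₂_sq)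
  have h0 : W.toAffine.polynomial.evalEval x y = 0 := h
  simp only [evalEval_pow, evalEval_add, evalEval_mul, h0, mul_zero, add_zero, evalEval_C] at hsq
  rw [← hsq, ψ₂, Affine.evalEval_polynomialY]

/-- **The algebra of the `ψ₃` part**: on a point `(x, y)` of a Weierstrass curve `V` over a field of
characteristic `ℓ ≠ 2`, if `q = ℓ^m = 2e + 1`, `x^q = x`, `Ψ₂Sq(x)^e = 1`, `a₁^q = a₁` and `a₃^q = a₃`,
then `y^q = y`: with `z = 2y + a₁x + a₃` one has `z² = Ψ₂Sq(x)`, so `z^q = z·(z²)^e = z`, and the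
`q`-power map is additive. [cite: SilvermanAEC2009, III.1 and Exercise 3.7 (f)] -/
theorem pow_eq_of_equation_of_Ψ₂Sq_pow_eq_one {K : Type*} [Field K] {ℓ : ℕ} [Fact ℓ.Prime] [CharP K ℓ]
    (hℓ2 : ℓ ≠ 2) (V : WeierstrassCurve K) {x y : K} (heq : V.toAffine.Equation x y) {m e : ℕ}
    (he : 2 * e + 1 = ℓ ^ m) (hx : x ^ (ℓ ^ m) = x) (hD : ((V.Ψ₂Sq).eval x) ^ e = 1)
    (ha₁ : V.a₁ ^ (ℓ ^ m) = V.a₁) (ha₃ : V.a₃ ^ (ℓ ^ m) = V.a₃) : y ^ (ℓ ^ m) = y := by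
  have hsq := eval_Ψ₂Sq_eq_sq_of_equation V heq
  have hzq : (2 * y + V.a₁ * x + V.a₃) ^ (ℓ ^ m) = 2 * y + V.a₁ * x + V.a₃ := by
    rw [← he, pow_succ, pow_mul, ← hsq, hD, one_mul]
  have h2 : (2 : K) ^ (ℓ ^ m) = 2 := by
    rw [show (2 : K) = 1 + 1 by norm_num, add_pow_char_pow (p := ℓ), one_pow]
  have hF : (2 * y + V.a₁ * x + V.a₃) ^ (ℓ ^ m)
      = 2 ^ (ℓ ^ m) * y ^ (ℓ ^ m) + V.a₁ ^ (ℓ ^ m) * x ^ (ℓ ^ m) + V.a₃ ^ (ℓ ^ m) := by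
    rw [add_pow_char_pow (p := ℓ), add_pow_char_pow (p := ℓ), mul_pow, mul_pow]
  rw [hF, h2, ha₁, ha₃, hx] at hzq
  have h2ne : (2 : K) ≠ 0 := by
    intro h0
    have h0' : ((2 : ℕ) : K) = 0 := by exact_mod_cast h0
    rw [CharP.cast_eq_zero_iff K ℓ] at h0'
    exact hℓ2 ((Nat.prime_dvd_prime_iff_eq Fact.out Nat.prime_two).mp h0')
  have h2y : (2 : K) * y ^ (ℓ ^ m) = 2 * y := by linear_combination hzq
  exact mul_left_cancel₀ h2ne h2y

section Points

variable {ℓ : ℕ} [Fact ℓ.Prime] {K : Type*} [Field K] {E₀ : WeierstrassCurve ℤ}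

/-- A ring homomorphism `ι : ℤ/ℓ → K` makes `K` a ring of characteristic `ℓ`. [folklore] -/
private theorem charP_of_ringHom (ι : ZMod ℓ →+* K) : CharP K ℓ :=
  charP_of_injective_ringHom ι.injective ℓ

/-- The `q = ℓ^m`-power map of `K ⊇ ι(ℤ/ℓ)` fixes the image of `ℤ/ℓ`. [folklore] -/
private theorem pow_apply_intCast (ι : ZMod ℓ →+* K) (m : ℕ) (a : ℤ) :
    (ι ((a : ℤ) : ZMod ℓ)) ^ (ℓ ^ m) = ι ((a : ℤ) : ZMod ℓ) := by
  rw [← map_pow, ZMod.pow_card_pow]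

/-- **A `9`-torsion point of `Ẽ_K = (E₀ mod ℓ).map ι` whose abscissa is NOT fixed by `x ↦ x^{ℓ^m}`**, for
`ℓ ∤ Δ(E₀)`, `K ⊇ ι(ℤ/ℓ)` algebraically closed and a checked certificate. [cite: SilvermanAEC2009, Exercise 3.7 (f)] -/
theorem exists_point_nine_torsion_pow_ne_of_check [IsAlgClosed K] (ι : ZMod ℓ →+* K)
    (hΔ : ¬ (ℓ : ℤ) ∣ E₀.Δ) {m : ℕ}
    {g h u v : List ℤ} {chain chainX chainD : List (Bool × List ℤ × List ℤ)}
    (hc : check ℓ E₀ m g h chain u v chainX chainD = true) :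
    ∃ x₀ y₀ : K,
      ∃ hP : (((E₀.map (Int.castRingHom (ZMod ℓ))).map ι).toAffine.Nonsingular x₀ y₀),
      (9 : ℤ) • (Affine.Point.some x₀ y₀ hP) = 0 ∧ x₀ ^ (ℓ ^ m) ≠ x₀ := by
  letI : Algebra (ZMod ℓ) K := ι.toAlgebra
  have hj : algebraMap (ZMod ℓ) K = ι := rfl
  simp only [check, Bool.and_eq_true] at hc
  obtain ⟨x₀, hx₀, hfrob⟩ := exists_root_pow_ne_of_check9 (ℓ := ℓ) K hc.1
  have hΔt : (E₀.map (Int.castRingHom (ZMod ℓ))).Δ ≠ 0 := by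
    rw [map_Δ, eq_intCast, Ne, ZMod.intCast_zmod_eq_zero_iff_dvd]
    exact hΔ
  have hΔV : ((E₀.map (Int.castRingHom (ZMod ℓ))).map ι).Δ ≠ 0 := by
    rw [map_Δ]
    exact (map_ne_zero_iff _ ι.injective).mpr hΔt
  set V : WeierstrassCurve K := (E₀.map (Int.castRingHom (ZMod ℓ))).map ι with hV
  have hqdeg : (Polynomial.C (1 : K) * X ^ 2 + Polynomial.C (V.a₁ * x₀ + V.a₃) * X +
      Polynomial.C (-(x₀ ^ 3 + V.a₂ * x₀ ^ 2 + V.a₄ * x₀ + V.a₆))).degree = 2 :=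
    degree_quadratic one_ne_zero
  obtain ⟨y₀, hy₀⟩ := IsAlgClosed.exists_root _ (by rw [hqdeg]; decide)
  have heq : V.toAffine.Equation x₀ y₀ := by
    rw [Affine.equation_iff]
    rw [IsRoot.def] at hy₀
    simp only [eval_add, eval_mul, eval_C, eval_pow, eval_X, one_mul] at hy₀
    linear_combination hy₀
  have hP : V.toAffine.Nonsingular x₀ y₀ := (Affine.equation_iff_nonsingular_of_Δ_ne_zero hΔV).mp heq
  refine ⟨x₀, y₀, hP, ?_, hfrob⟩
  rw [Affine.Point.zsmul_some_eq_zero_iff hP 9]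
  have h9 : ((9 : ℕ) : ℤ) = 9 := by norm_num
  rw [← h9, evalEval_ψ_eq_eval_preΨ'_of_equation V heq 9 (by decide), hV, map_preΨ', eval_map,
    ← hj, ← aeval_def]
  exact hx₀

/-- **Every `3`-torsion point of `Ẽ_K` is fixed coordinatewise by `x ↦ x^{ℓ^m}`**, for `ℓ ≠ 2`,
`K ⊇ ι(ℤ/ℓ)` a field and a checked certificate (its `ψ₃` part): if `(x, y)` is a nonsingular point of
`Ẽ_K = (E₀ mod ℓ).map ι` with `(3 : ℤ) • (x, y) = O` then `x ^ {ℓ^m} = x` and `y ^ {ℓ^m} = y`.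
[cite: SilvermanAEC2009, Exercise 3.7 (f) and III.2.3] -/
theorem pow_eq_of_three_torsion_of_check (ι : ZMod ℓ →+* K) (hℓ2 : ℓ ≠ 2) {m : ℕ}
    {g h u v : List ℤ} {chain chainX chainD : List (Bool × List ℤ × List ℤ)}
    (hc : check ℓ E₀ m g h chain u v chainX chainD = true) {x y : K}
    (hP : (((E₀.map (Int.castRingHom (ZMod ℓ))).map ι).toAffine.Nonsingular x y))
    (h3 : (3 : ℤ) • (Affine.Point.some x y hP) = 0) :
    x ^ (ℓ ^ m) = x ∧ y ^ (ℓ ^ m) = y := by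
  letI : Algebra (ZMod ℓ) K := ι.toAlgebra
  have hj : algebraMap (ZMod ℓ) K = ι := rfl
  haveI : CharP K ℓ := charP_of_ringHom ι
  simp only [check, Bool.and_eq_true] at hc
  obtain ⟨e, he, hroots⟩ := pow_eq_of_check3 (ℓ := ℓ) K hc.2
  have heq : ((E₀.map (Int.castRingHom (ZMod ℓ))).map ι).toAffine.Equation x y := hP.1
  -- `Ψ₃(x) = 0`
  have hψ3 : ((E₀.map (Int.castRingHom (ZMod ℓ))).Ψ₃).aeval x = 0 := by
    have h := (Affine.Point.zsmul_some_eq_zero_iff hP 3).mp h3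
    have h3' : ((3 : ℕ) : ℤ) = 3 := by norm_num
    rw [← h3', evalEval_ψ_eq_eval_preΨ'_of_equation _ heq 3 (by decide), preΨ'_three, map_Ψ₃,
      eval_map, ← hj, ← aeval_def] at h
    exact h
  obtain ⟨hx, hD⟩ := hroots x hψ3
  refine ⟨hx, ?_⟩
  -- the hypotheses of the algebra lemma, for `V = Ẽ_K`
  have hD' : ((((E₀.map (Int.castRingHom (ZMod ℓ))).map ι).Ψ₂Sq).eval x) ^ e = 1 := by
    rw [map_Ψ₂Sq, eval_map, ← hj, ← aeval_def]
    exact hD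
  have ha₁ : ((E₀.map (Int.castRingHom (ZMod ℓ))).map ι).a₁ ^ (ℓ ^ m)
      = ((E₀.map (Int.castRingHom (ZMod ℓ))).map ι).a₁ := by
    rw [map_a₁, map_a₁, eq_intCast]; exact pow_apply_intCast ι m E₀.a₁
  have ha₃ : ((E₀.map (Int.castRingHom (ZMod ℓ))).map ι).a₃ ^ (ℓ ^ m)
      = ((E₀.map (Int.castRingHom (ZMod ℓ))).map ι).a₃ := by
    rw [map_a₃, map_a₃, eq_intCast]; exact pow_apply_intCast ι m E₀.a₃
  exact pow_eq_of_equation_of_Ψ₂Sq_pow_eq_one hℓ2 _ heq he hx hD' ha₁ ha₃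

end Points

end Summit.BirchSwinnertonDyer.Rank1Residual.GaloisImage.Frob9

end
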